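import Literature.Analysis.UnboundedOperators.HeatKernel
import Mathlib.Analysis.SpecialFunctions.ImproperIntegrals
import HarnessLib

/-!
# Off-diagonal bounds for the Gaussian and an integrable time profile

Analysis/FluidPDE support file (theorems only; real analysis) for the proof of the named fact
`Literature.Analysis.FluidPDE.bradshawGrujicKukavica2015_local_analyticity_radius`
(Bradshaw–Grujić–Kukavica 2015, §4: the forcing of the localised equation lives on the cut-off
annulus, at distance `≥ D` from the points where analyticity is established, so only
**off-diagonal** values of the heat kernel and of its derivatives enter, and these are bounded
uniformly in the time):

* `exp_neg_le_factorial_div_pow` — `e^{-x} ≤ n!/xⁿ` (`x > 0`);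
* `heatKernel_le_of_le_norm` — `G_c(z) ≤ (4πc)^{-d/2} e^{-D²/(4c)}` for `‖z‖ ≥ D`;
* `rpow_neg_mul_exp_neg_div_le` — `c^{-q} e^{-a/c} ≤ n! a^{-n} c^{n-q}` (`a, c > 0`), whence the
  **uniform off-diagonal Gaussian bound** `exists_forall_heatKernel_le_of_le_norm`:
  `sup {G_c(z) : 0 < c ≤ c₁, ‖z‖ ≥ D} < ∞`;
* `integrableOn_Ioi_rpow_mul_exp_neg_div` — `σ ↦ σ^{-1-e} e^{-a/σ}` is integrable on `(0, ∞)`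
  for `a > 0`, `e > 0` (the time profile of the off-diagonal Hessian of the Gaussian,
  `∫₀^∞ |∂²G_σ(z)| dσ < ∞` for `z ≠ 0`).

## References

* Z. Bradshaw, Z. Grujić, I. Kukavica, J. Differential Equations 259 (2015), §4. [BradshawGrujicKukavica2015]
* Folklore (elementary Gaussian estimates).
-/

noncomputable section

open MeasureTheory Set Filter Metric Real
open _root_.Topology
open scoped Nat

namespace Literature.Analysis.FluidPDE

open UnboundedOperators (heatKernel)

/-! ### Elementary inequalities -/

/-- `e^{-x} ≤ n!/xⁿ` for `x > 0`. [folklore] -/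
theorem exp_neg_le_factorial_div_pow {x : ℝ} (hx : 0 < x) (n : ℕ) :
    Real.exp (-x) ≤ (n ! : ℝ) / x ^ n := by
  have h := Real.pow_div_factorial_le_exp (x := x) hx.le n
  have hn : (0 : ℝ) < n ! := by exact_mod_cast Nat.factorial_pos n
  rw [div_le_iff₀ hn] at h
  rw [Real.exp_neg, inv_eq_one_div, div_le_div_iff₀ (Real.exp_pos x) (pow_pos hx n), one_mul]
  linarith

/-- **`c^{-q} e^{-a/c} ≤ n! a^{-n} c^{n-q}`** for `a, c > 0` and any real `q`, natural `n`.
[folklore] -/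
theorem rpow_neg_mul_exp_neg_div_le {a c : ℝ} (ha : 0 < a) (hc : 0 < c) (q : ℝ) (n : ℕ) :
    c ^ (-q) * Real.exp (-(a / c)) ≤ (n ! : ℝ) * a ^ (-(n : ℝ)) * c ^ ((n : ℝ) - q) := by
  have h1 := exp_neg_le_factorial_div_pow (div_pos ha hc) n
  have hcq : 0 < c ^ (-q) := Real.rpow_pos_of_pos hc _
  calc c ^ (-q) * Real.exp (-(a / c)) ≤ c ^ (-q) * ((n ! : ℝ) / (a / c) ^ n) :=
        mul_le_mul_of_nonneg_left h1 hcq.le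
    _ = (n ! : ℝ) * a ^ (-(n : ℝ)) * c ^ ((n : ℝ) - q) := by
        rw [div_pow, Real.rpow_neg ha.le, Real.rpow_natCast, Real.rpow_sub hc, Real.rpow_natCast,
          Real.rpow_neg hc.le]
        field_simp

/-! ### Off-diagonal Gaussian bounds -/

/-- **The Gaussian off the diagonal**: `G_c(z) ≤ (4πc)^{-d/2} e^{-D²/(4c)}` for `c > 0`,
`0 ≤ D ≤ ‖z‖`. [folklore] -/
theorem heatKernel_le_of_le_norm {E : Type*} [NormedAddCommGroup E] [InnerProductSpace ℝ E]
    {c : ℝ} (hc : 0 < c) {D : ℝ} (hD : 0 ≤ D) {z : E} (hz : D ≤ ‖z‖) :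
    heatKernel c z ≤ (4 * π * c) ^ (-(Module.finrank ℝ E : ℝ) / 2) * Real.exp (-(D ^ 2 / (4 * c))) := by
  unfold UnboundedOperators.heatKernel
  refine mul_le_mul_of_nonneg_left (Real.exp_le_exp.2 ?_) (Real.rpow_nonneg (by positivity) _)
  rw [neg_div, neg_le_neg_iff]
  gcongr

/-- **Uniform off-diagonal Gaussian bound**: for `D > 0` and `c₁ > 0` there is `C` (explicitly
`d! (D²/4)^{-d} (4π)^{-d/2} max(c₁,1)^{d}`) with `G_c(z) ≤ C` whenever `0 < c ≤ c₁` and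
`‖z‖ ≥ D`. [folklore] -/
theorem exists_forall_heatKernel_le_of_le_norm (E : Type*) [NormedAddCommGroup E]
    [InnerProductSpace ℝ E] {D : ℝ} (hD : 0 < D) {c₁ : ℝ} (hc₁ : 0 < c₁) :
    ∃ C : ℝ, 0 ≤ C ∧ ∀ {c : ℝ}, 0 < c → c ≤ c₁ → ∀ {z : E}, D ≤ ‖z‖ → heatKernel c z ≤ C := by
  set d : ℕ := Module.finrank ℝ E with hd
  set a : ℝ := D ^ 2 / 4 with ha
  have ha0 : 0 < a := by positivity
  set C : ℝ := (4 * π) ^ (-(d : ℝ) / 2) * ((d ! : ℝ) * a ^ (-(d : ℝ)) * (max c₁ 1) ^ ((d : ℝ) - (d : ℝ) / 2))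
    with hC
  refine ⟨C, by positivity, fun {c} hc hcc₁ {z} hz => ?_⟩
  have h1 := heatKernel_le_of_le_norm hc hD.le hz
  rw [← hd] at h1
  refine h1.trans ?_
  have hsplit : (4 * π * c) ^ (-(d : ℝ) / 2) = (4 * π) ^ (-(d : ℝ) / 2) * c ^ (-((d : ℝ) / 2)) := by
    rw [Real.mul_rpow (by positivity) hc.le, neg_div]
  rw [hsplit, mul_assoc, show D ^ 2 / (4 * c) = a / c by rw [ha]; field_simp]
  refine mul_le_mul_of_nonneg_left ?_ (Real.rpow_nonneg (by positivity) _)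
  refine (rpow_neg_mul_exp_neg_div_le ha0 hc ((d : ℝ) / 2) d).trans ?_
  have hexp : 0 ≤ (d : ℝ) - (d : ℝ) / 2 := by
    have : (0 : ℝ) ≤ d := Nat.cast_nonneg d
    linarith
  have hcm : c ^ ((d : ℝ) - (d : ℝ) / 2) ≤ (max c₁ 1) ^ ((d : ℝ) - (d : ℝ) / 2) :=
    Real.rpow_le_rpow hc.le (hcc₁.trans (le_max_left _ _)) hexp
  exact mul_le_mul_of_nonneg_left hcm (by positivity)

/-! ### The time profile of the off-diagonal Hessian -/

/-- **`σ ↦ σ^{-1-e} e^{-a/σ}` is integrable on `(0, ∞)`** for `a > 0`, `e > 0`: near `0` the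
exponential beats every power, at infinity the power `-1-e < -1` is integrable. [folklore] -/
theorem integrableOn_Ioi_rpow_mul_exp_neg_div {a e : ℝ} (ha : 0 < a) (he : 0 < e) :
    IntegrableOn (fun σ : ℝ => σ ^ (-(1 + e)) * Real.exp (-(a / σ))) (Ioi 0) := by
  -- continuity on `(0, ∞)`
  have hcont : ContinuousOn (fun σ : ℝ => σ ^ (-(1 + e)) * Real.exp (-(a / σ))) (Ioi 0) := by
    refine ContinuousOn.mul (ContinuousOn.rpow_const continuousOn_id fun σ hσ => Or.inl (ne_of_gt hσ)) ?_
    exact (Real.continuous_exp.comp_continuousOn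
      ((continuousOn_const.div continuousOn_id fun σ hσ => ne_of_gt hσ).neg))
  -- split at `σ = a`
  have hsplit : Ioi (0 : ℝ) = Ioc 0 a ∪ Ioi a := (Ioc_union_Ioi_eq_Ioi ha.le).symm
  rw [hsplit]
  refine IntegrableOn.union ?_ ?_
  · -- on `(0, a]`: bounded by a constant
    obtain ⟨n, hn⟩ : ∃ n : ℕ, 1 + e ≤ n := exists_nat_ge (1 + e)
    set B : ℝ := (n ! : ℝ) * a ^ (-(n : ℝ)) * a ^ ((n : ℝ) - (1 + e)) with hB
    have hbd : ∀ σ ∈ Ioc (0 : ℝ) a, ‖σ ^ (-(1 + e)) * Real.exp (-(a / σ))‖ ≤ B := by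
      intro σ hσ
      rw [Real.norm_of_nonneg (mul_nonneg (Real.rpow_nonneg hσ.1.le _) (Real.exp_pos _).le)]
      refine (rpow_neg_mul_exp_neg_div_le ha hσ.1 (1 + e) n).trans ?_
      rw [hB]
      refine mul_le_mul_of_nonneg_left (Real.rpow_le_rpow hσ.1.le hσ.2 (by linarith)) (by positivity)
    have hconst : IntegrableOn (fun _ : ℝ => B) (Ioc 0 a) := integrableOn_const measure_Ioc_lt_top.ne
    refine hconst.mono' ((hcont.mono Ioc_subset_Ioi_self).aestronglyMeasurable measurableSet_Ioc) ?_
    exact (ae_restrict_iff' measurableSet_Ioc).2 (Eventually.of_forall hbd)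
  · -- on `(a, ∞)`: dominated by the integrable power
    have hpow := integrableOn_Ioi_rpow_of_lt (show -(1 + e) < -1 by linarith) ha
    refine hpow.mono' ((hcont.mono (Ioi_subset_Ioi ha.le)).aestronglyMeasurable measurableSet_Ioi) ?_
    refine (ae_restrict_iff' measurableSet_Ioi).2 (Eventually.of_forall fun σ hσ => ?_)
    have hσ0 : 0 < σ := ha.trans hσ
    rw [Real.norm_of_nonneg (mul_nonneg (Real.rpow_nonneg hσ0.le _) (Real.exp_pos _).le)]
    refine mul_le_of_le_one_right (Real.rpow_nonneg hσ0.le _) ?_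
    rw [Real.exp_le_one_iff, neg_nonpos]
    positivity

end Literature.Analysis.FluidPDE
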